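import Literature.MathematicalPhysics.QuantumFieldTheory.Balaban1983to89.B8ExpMeanLogCrossTermGeomRec

/-!
# `Balaban1983to89.B8ExpMeanLogCrossTermUnitaryRec` — [Balaban1985Averaging] (78)–(81), (22)–(23): THE CROSS-TERM BOUND OF THE RECORD AVERAGE OF A PRODUCT OF TWO UNITARY GAUGE
# FUNCTIONS UNDER A CELL WITH NO `U1` HYPOTHESES — the product's own averages are unitary under the cell (intertwined induction: the cross-term bound at level `i` makes the
# product's (78) families small, hence its level-`(i+1)` average unitary), so the five `U1` rows of ✓p747787 `rbar_one_mul_sub_mul_le_geom_local_at` discharge themselves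

statement-level skeleton of published theorems with citation tags; proofs where landed; nothing here is a claim about the Yang–Mills mass gap

CITATION HEADER (lean-in-tree rule).  Cell `pub-ymgap` (HUMAN RULING D-0062), the N05-REC → K0-road JUNCTION (width seat `pub-ymgap-dag-n07-w3` g13).  [3] = [Balaban1985Averaging] (78)–(81) p. 30,
(22)–(23) p. 21, (26)–(27) pp. 21–22, (166)–(167) p. 44; [6] = [Balaban1985RegularSpaces] (1.29) p. 81; [I] = [Balaban1987RG1] (0.3)–(0.4) pp. 252–253.  `--kind proof --supports
stmt-QuantumFields-20541` (K0⁷; count-neutral; no definition).  REUSED BY NAME: this seat's ✓p747787∕✓p748782 `B8ExpMeanLogCrossTermGeomRec.{rbar_one_mul_sub_mul_le_geom_local_at,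
uavgZ_one_mem_unitaryUnits_under, norm_uavgZ_one_le_one_under}`, dag-n05-e's `B7SectCDGaugeAveragesRec.{uavgZ, uavgZ_succ, SexpZ}`, `B8Eq178AveragesRec.rbar_bgTZ_eq_uavgZ`,
`B7Prop2Explicit.{unitaryUnits, star_mlog_eq_neg, unitaryUnits_le_U1}`, `B8BlockConstantLiftStabilityRec.underZ_add`, dag-n05-d's `B8Eq119TwistedAxialRec.{UnderZ, underZ_one_block, underZ_one_centre}`.

WHY.  The junction's row 9′ is the record average `R̄₀ʲ(a·u₀)(y)` of a PRODUCT of two unitary gauge functions (road (B′): `a = τ·X⁻¹`, `u₀` Theorem 4's gauge); ✓p747787 bounds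
`‖R̄₀ʲ(a·u₀) − R̄₀ʲa·R̄₀ʲu₀‖ ≤ 1024·s²` from the oscillation rows but ASKS five `U1` rows, among them `‖(R̄₀ⁱ(a·u₀)(L·z))⁻¹‖ ≤ 1` for the product itself — which nobody supplies directly.
THIS FILE discharges them in the C⋆ setting: the averages of `a` and of `u₀` are unitary under the cell by ✓p748782 §4 (their rows are `≤ 1∕4`), and the product's averages are unitary by
an induction intertwined with the cross-term bound one level down — at level `i` the bound (applied at the sub-cells `L·z`, `L·z + r` with the geometric letter `s·θ^{j−i}`) puts the
product's (78) family within `p_i + q_i + 2·1024·(sθ^{j−i})² ≤ 1∕4` of `1`, so the level-`(i+1)` exponent is skew-adjoint ([3] (22)–(23)) and the average unitary.  Price: `s ≤ 1∕128`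
instead of `1∕32` (immaterial at the record, `s ∼ κ·ε`).

WHAT IS PROVED (sorry-free; C⋆-algebra carrier).
§1 bookkeeping (rows of a sub-cell, the `1∕4`-rows of the factors).
§2 ★★★ `uavgZ_one_mul_mem_unitaryUnits_under` — under the rows of ✓p747787 (geometric letters `p_i + q_i ≤ s·θ^{j−(i+1)}`, `θ ≤ 1∕2`, `s ≤ 1∕128`, `1024θs ≤ 1`) and pointwise unitarity of
   `a`, `u` under the cell: `R̄₀ⁱ(a·u)(z)` is unitary for every `i ≤ j`, `z` under `y` at depth `j − i` (and so are `R̄₀ⁱa(z)`, `R̄₀ⁱu(z)`).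
§3 ★★★ `norm_uavgZ_one_mul_sub_mul_le_of_unitary` — `‖R̄₀ʲ(a·u)(y) − R̄₀ʲa(y)·R̄₀ʲu(y)‖ ≤ 1024·s²` with NO `U1` hypotheses; ★★★ `norm_uavgZ_one_mul_sub_one_le_of_unitary` — with
   `R̄₀ʲa(y) = 1`, `R̄₀ʲu(y) = 1`: `‖R̄₀ʲ(a·u)(y) − 1‖ ≤ 1024·s²` (road (B′)'s row 9′ up to `ψ₂`, the junction's working shape).
HONEST FRAMING: count-neutral helper; an elementary C⋆ bookkeeping on top of ✓p747787 — nothing of [3]∕[6]∕[I] asserted or discharged; the oscillation rows (`p`, `q`) are INPUTS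
(this seat's ✓p753816 ∕ ✓p754021 ∕ ✓p755045 produce them from the two axialities ∕ the adjacent-centre letters); `HThm4RecSym152PhiE(G)` ∕ `HThm4Rec*` UNDISCHARGED; N07 ∕ N05 NOT discharged;
K0⁷ ∕ K1⁹ NOT closed; counts unmoved (typed 28∕28 · discharged 8∕28); one finite 𝕋⁴ programme at fixed ε — R4 closes the conditional finite-𝕋⁴ rung `BalabanLadder.UV` only; the YM
mass gap (Clay) is NOT proved by any of this; nothing continuum ∕ ℝ⁴ ∕ OS.  No `def`, no `sorry`, no `instance`, no `notation`.
-/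

set_option autoImplicit false

noncomputable section

open scoped BigOperators

namespace Literature.MathematicalPhysics.QuantumFieldTheory.Balaban1983to89.B8ExpMeanLogCrossTermUnitaryRec

open B7Prop1Explicit hiding Site
open B7Prop1Explicit renaming Site → SiteZ
open B7Eq78Linearization (Rbar)
open B7SectEFLinearisationRec (zdBlockingZ bgTZ blockSitesZ mem_blockSitesZ)
open B7SectCDGaugeAveragesRec (uavgZ uavgZ_zero uavgZ_succ SexpZ)
open B8Eq119TwistedAxialRec (UnderZ underZ_zero_iff underZ_one_block underZ_one_centre)
open B8Eq178AveragesRec (rbar_bgTZ_eq_uavgZ)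
open B8BlockConstantLiftStabilityRec (underZ_add)
open B8ExpMeanLogCrossTermGeomRec (rbar_one_mul_sub_mul_le_geom_local_at uavgZ_one_mem_unitaryUnits_under norm_uavgZ_one_le_one_under)
open B7Prop2Explicit (unitaryUnits mem_unitaryUnits star_mlog_eq_neg unitaryUnits_le_U1)
open B7Eq170Flat (bmean norm_bmean_le)
open BlockAveragingZd (offZ)
open MatrixLog (mlog norm_mlog_le_two_mul)

variable {d : ℕ} {𝔹 : Type*} [CStarAlgebra 𝔹] [Nontrivial 𝔹]

/-! ## §1  Bookkeeping: sub-cells, the factors' `1∕4`-rows, units algebra -/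

omit [Nontrivial 𝔹] in
/-- `‖X·Y − 1‖ ≤ ‖X − 1‖ + ‖Y − 1‖` when `‖X‖ ≤ 1`. [folklore] -/
private theorem norm_mul_sub_one_le_add {X Y : 𝔹} (hX : ‖X‖ ≤ 1) : ‖X * Y - 1‖ ≤ ‖X - 1‖ + ‖Y - 1‖ := by
  have h : X * Y - 1 = X * (Y - 1) + (X - 1) := by noncomm_ring
  rw [h]
  calc ‖X * (Y - 1) + (X - 1)‖ ≤ ‖X * (Y - 1)‖ + ‖X - 1‖ := norm_add_le _ _
    _ ≤ ‖X‖ * ‖Y - 1‖ + ‖X - 1‖ := by gcongr; exact norm_mul_le _ _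
    _ ≤ 1 * ‖Y - 1‖ + ‖X - 1‖ := by gcongr
    _ = ‖X - 1‖ + ‖Y - 1‖ := by ring

/-- A point `z` under the sub-cell `x₀` (itself under `y` at depth `j − i₀`) at depth `i₀ − (l+1)` is under `y` at depth `j − (l+1)`. [cite: Balaban1987RG1, (0.3) p.252 (bookkeeping)] -/
private theorem underZ_of_sub {L : ℕ} (hL : Odd L) {j i₀ l : ℕ} {y x₀ z : SiteZ d} (hx₀ : UnderZ L (j - i₀) y x₀) (hl : l < i₀) (hi₀ : i₀ ≤ j)
    (hz : UnderZ L (i₀ - (l + 1)) x₀ z) : UnderZ L (j - (l + 1)) y z := by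
  have h := underZ_add hL hx₀ hz
  rwa [show j - i₀ + (i₀ - (l + 1)) = j - (l + 1) by omega] at h

section Main

/-- The geometric letters are `≤ 1∕4` at every level (indeed `≤ s ≤ 1∕128`). [cite: Balaban1985Averaging, (167) p.44 (bookkeeping)] -/
private theorem pq_le_quarter {j : ℕ} {p q : ℕ → ℝ} {s θ : ℝ} (hp0 : ∀ i, 0 ≤ p i) (hq0 : ∀ i, 0 ≤ q i) (hθ0 : 0 ≤ θ) (hθ2 : θ ≤ 1 / 2) (hs0 : 0 ≤ s) (hs128 : s ≤ 1 / 128)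
    (hpq : ∀ i, i < j → p i + q i ≤ s * θ ^ (j - (i + 1)))
    {i : ℕ} (hij : i < j) : p i ≤ 1 / 4 ∧ q i ≤ 1 / 4 := by
  have h := hpq i hij
  have ht : θ ^ (j - (i + 1)) ≤ 1 := pow_le_one₀ hθ0 (hθ2.trans (by norm_num))
  have hs' : s * θ ^ (j - (i + 1)) ≤ s := by nlinarith
  have := hp0 i; have := hq0 i
  constructor <;> linarith

omit [Nontrivial 𝔹] in
/-- The `h167`-shaped `1∕4`-rows of `a` under the cell. [cite: Balaban1985Averaging, (167) p.44 (bookkeeping)] -/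
private theorem h167_a {L : ℕ} (a : SiteZ d → 𝔹ˣ) {j : ℕ} {y : SiteZ d} {p q : ℕ → ℝ} {s θ : ℝ} (hp0 : ∀ i, 0 ≤ p i) (hq0 : ∀ i, 0 ≤ q i) (hθ0 : 0 ≤ θ) (hθ2 : θ ≤ 1 / 2) (hs0 : 0 ≤ s) (hs128 : s ≤ 1 / 128)
    (hpq : ∀ i, i < j → p i + q i ≤ s * θ ^ (j - (i + 1)))
    (hp : ∀ i, i < j → ∀ z, UnderZ L (j - (i + 1)) y z → ∀ x ∈ blockSitesZ L z,
      ‖(((uavgZ L (1 : SiteZ d → Fin d → 𝔹ˣ) a i ((L : ℤ) • z))⁻¹ : 𝔹ˣ) : 𝔹) * ((uavgZ L (1 : SiteZ d → Fin d → 𝔹ˣ) a i x : 𝔹ˣ) : 𝔹) - 1‖ ≤ p i) :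
    ∀ i, i < j → ∀ z, UnderZ L (j - (i + 1)) y z → ∀ r : Fin d → Fin L,
    ‖((((uavgZ L (1 : SiteZ d → Fin d → 𝔹ˣ) a i ((L : ℤ) • z))⁻¹ * uavgZ L (1 : SiteZ d → Fin d → 𝔹ˣ) a i ((L : ℤ) • z + offZ L r) : 𝔹ˣ)) : 𝔹) - 1‖ ≤ 1 / 4 := by
  intro i hij z hz r
  rw [Units.val_mul]
  exact (hp i hij z hz _ (mem_blockSitesZ.2 ⟨r, rfl⟩)).trans (pq_le_quarter hp0 hq0 hθ0 hθ2 hs0 hs128 hpq hij).1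

omit [Nontrivial 𝔹] in
/-- The `h167`-shaped `1∕4`-rows of `u` under the cell. [cite: Balaban1985Averaging, (167) p.44 (bookkeeping)] -/
private theorem h167_u {L : ℕ} (u : SiteZ d → 𝔹ˣ) {j : ℕ} {y : SiteZ d} {p q : ℕ → ℝ} {s θ : ℝ} (hp0 : ∀ i, 0 ≤ p i) (hq0 : ∀ i, 0 ≤ q i) (hθ0 : 0 ≤ θ) (hθ2 : θ ≤ 1 / 2) (hs0 : 0 ≤ s) (hs128 : s ≤ 1 / 128)
    (hpq : ∀ i, i < j → p i + q i ≤ s * θ ^ (j - (i + 1)))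
    (hq : ∀ i, i < j → ∀ z, UnderZ L (j - (i + 1)) y z → ∀ x ∈ blockSitesZ L z,
      ‖(((uavgZ L (1 : SiteZ d → Fin d → 𝔹ˣ) u i ((L : ℤ) • z))⁻¹ : 𝔹ˣ) : 𝔹) * ((uavgZ L (1 : SiteZ d → Fin d → 𝔹ˣ) u i x : 𝔹ˣ) : 𝔹) - 1‖ ≤ q i) :
    ∀ i, i < j → ∀ z, UnderZ L (j - (i + 1)) y z → ∀ r : Fin d → Fin L,
    ‖((((uavgZ L (1 : SiteZ d → Fin d → 𝔹ˣ) u i ((L : ℤ) • z))⁻¹ * uavgZ L (1 : SiteZ d → Fin d → 𝔹ˣ) u i ((L : ℤ) • z + offZ L r) : 𝔹ˣ)) : 𝔹) - 1‖ ≤ 1 / 4 := by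
  intro i hij z hz r
  rw [Units.val_mul]
  exact (hq i hij z hz _ (mem_blockSitesZ.2 ⟨r, rfl⟩)).trans (pq_le_quarter hp0 hq0 hθ0 hθ2 hs0 hs128 hpq hij).2

/-- ★ **THE CROSS-TERM BOUND AT A SUB-CELL**: for `i₀ ≤ j` and `x₀` under `y` at depth `j − i₀`, if the product's averages below level `i₀` are unitary at the centres under `x₀`, then
`‖R̄₀^{i₀}(a·u)(x₀) − R̄₀^{i₀}a(x₀)·R̄₀^{i₀}u(x₀)‖ ≤ 1024·(s·θ^{j−i₀})²` (✓p747787 at the cell `(i₀, x₀)` with the letter `s·θ^{j−i₀}`; its `U1` rows from unitarity).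
[cite: Balaban1985Averaging, (78)–(81) p.30, (167) p.44; Balaban1987RG1, (0.3)–(0.4) pp.252–253] -/
theorem norm_uavgZ_one_mul_sub_mul_le_at_sub {L : ℕ} (hL : Odd L) (a u : SiteZ d → 𝔹ˣ) (j : ℕ) (y : SiteZ d) (p q : ℕ → ℝ) {s θ : ℝ}
    (hp0 : ∀ i, 0 ≤ p i) (hq0 : ∀ i, 0 ≤ q i) (hθ0 : 0 ≤ θ) (hθ2 : θ ≤ 1 / 2) (hs0 : 0 ≤ s) (hs128 : s ≤ 1 / 128) (hθs : 1024 * θ * s ≤ 1)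
    (hpq : ∀ i, i < j → p i + q i ≤ s * θ ^ (j - (i + 1)))
    (ha : ∀ x, UnderZ L j y x → a x ∈ unitaryUnits 𝔹) (hu : ∀ x, UnderZ L j y x → u x ∈ unitaryUnits 𝔹)
    (hp : ∀ i, i < j → ∀ z, UnderZ L (j - (i + 1)) y z → ∀ x ∈ blockSitesZ L z,
      ‖(((uavgZ L (1 : SiteZ d → Fin d → 𝔹ˣ) a i ((L : ℤ) • z))⁻¹ : 𝔹ˣ) : 𝔹) * ((uavgZ L (1 : SiteZ d → Fin d → 𝔹ˣ) a i x : 𝔹ˣ) : 𝔹) - 1‖ ≤ p i)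
    (hq : ∀ i, i < j → ∀ z, UnderZ L (j - (i + 1)) y z → ∀ x ∈ blockSitesZ L z,
      ‖(((uavgZ L (1 : SiteZ d → Fin d → 𝔹ˣ) u i ((L : ℤ) • z))⁻¹ : 𝔹ˣ) : 𝔹) * ((uavgZ L (1 : SiteZ d → Fin d → 𝔹ˣ) u i x : 𝔹ˣ) : 𝔹) - 1‖ ≤ q i)
    {i₀ : ℕ} (hi₀ : i₀ ≤ j) {x₀ : SiteZ d} (hx₀ : UnderZ L (j - i₀) y x₀)
    (hwU : ∀ l, l < i₀ → ∀ z, UnderZ L (i₀ - (l + 1)) x₀ z → uavgZ L (1 : SiteZ d → Fin d → 𝔹ˣ) (a * u) l ((L : ℤ) • z) ∈ unitaryUnits 𝔹) :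
    ‖((uavgZ L (1 : SiteZ d → Fin d → 𝔹ˣ) (a * u) i₀ x₀ : 𝔹ˣ) : 𝔹) -
        ((uavgZ L (1 : SiteZ d → Fin d → 𝔹ˣ) a i₀ x₀ : 𝔹ˣ) : 𝔹) * ((uavgZ L (1 : SiteZ d → Fin d → 𝔹ˣ) u i₀ x₀ : 𝔹ˣ) : 𝔹)‖ ≤ 1024 * (s * θ ^ (j - i₀)) ^ 2 := by
  have hθ1 : θ ≤ 1 := hθ2.trans (by norm_num)
  have htp : θ ^ (j - i₀) ≤ 1 := pow_le_one₀ hθ0 hθ1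
  have hs' : 0 ≤ s * θ ^ (j - i₀) := by positivity
  have hs32' : s * θ ^ (j - i₀) ≤ 1 / 32 := by nlinarith
  have hθs' : 1024 * θ * (s * θ ^ (j - i₀)) ≤ 1 := by
    have : 1024 * θ * (s * θ ^ (j - i₀)) ≤ 1024 * θ * s := by
      have h0 : 0 ≤ 1024 * θ * s := by positivity
      nlinarith
    linarith
  -- the rows of the sub-cell
  have hpq' : ∀ l, l < i₀ → p l + q l ≤ s * θ ^ (j - i₀) * θ ^ (i₀ - (l + 1)) := by
    intro l hl
    have h := hpq l (by omega)
    rwa [show j - (l + 1) = (j - i₀) + (i₀ - (l + 1)) by omega, pow_add, ← mul_assoc] at h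
  have ha' : ∀ x, UnderZ L i₀ x₀ x → a x ∈ unitaryUnits 𝔹 := fun x hx => ha x (by
    have h := underZ_add hL hx₀ hx; rwa [show j - i₀ + i₀ = j by omega] at h)
  have hu' : ∀ x, UnderZ L i₀ x₀ x → u x ∈ unitaryUnits 𝔹 := fun x hx => hu x (by
    have h := underZ_add hL hx₀ hx; rwa [show j - i₀ + i₀ = j by omega] at h)
  have hp' : ∀ l, l < i₀ → ∀ z, UnderZ L (i₀ - (l + 1)) x₀ z → ∀ x ∈ blockSitesZ L z,
      ‖(((uavgZ L (1 : SiteZ d → Fin d → 𝔹ˣ) a l ((L : ℤ) • z))⁻¹ : 𝔹ˣ) : 𝔹) * ((uavgZ L (1 : SiteZ d → Fin d → 𝔹ˣ) a l x : 𝔹ˣ) : 𝔹) - 1‖ ≤ p l :=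
    fun l hl z hz x hx => hp l (by omega) z (underZ_of_sub hL hx₀ hl hi₀ hz) x hx
  have hq' : ∀ l, l < i₀ → ∀ z, UnderZ L (i₀ - (l + 1)) x₀ z → ∀ x ∈ blockSitesZ L z,
      ‖(((uavgZ L (1 : SiteZ d → Fin d → 𝔹ˣ) u l ((L : ℤ) • z))⁻¹ : 𝔹ˣ) : 𝔹) * ((uavgZ L (1 : SiteZ d → Fin d → 𝔹ˣ) u l x : 𝔹ˣ) : 𝔹) - 1‖ ≤ q l :=
    fun l hl z hz x hx => hq l (by omega) z (underZ_of_sub hL hx₀ hl hi₀ hz) x hx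
  have h167a' : ∀ l, l < i₀ → ∀ z, UnderZ L (i₀ - (l + 1)) x₀ z → ∀ r : Fin d → Fin L,
      ‖((((uavgZ L (1 : SiteZ d → Fin d → 𝔹ˣ) a l ((L : ℤ) • z))⁻¹ * uavgZ L (1 : SiteZ d → Fin d → 𝔹ˣ) a l ((L : ℤ) • z + offZ L r) : 𝔹ˣ)) : 𝔹) - 1‖ ≤ 1 / 4 :=
    fun l hl z hz r => h167_a a hp0 hq0 hθ0 hθ2 hs0 hs128 hpq hp l (by omega) z (underZ_of_sub hL hx₀ hl hi₀ hz) r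
  have h167u' : ∀ l, l < i₀ → ∀ z, UnderZ L (i₀ - (l + 1)) x₀ z → ∀ r : Fin d → Fin L,
      ‖((((uavgZ L (1 : SiteZ d → Fin d → 𝔹ˣ) u l ((L : ℤ) • z))⁻¹ * uavgZ L (1 : SiteZ d → Fin d → 𝔹ˣ) u l ((L : ℤ) • z + offZ L r) : 𝔹ˣ)) : 𝔹) - 1‖ ≤ 1 / 4 :=
    fun l hl z hz r => h167_u u hp0 hq0 hθ0 hθ2 hs0 hs128 hpq hq l (by omega) z (underZ_of_sub hL hx₀ hl hi₀ hz) r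
  have hUa := norm_uavgZ_one_le_one_under hL a i₀ x₀ ha' h167a'
  have hUu := norm_uavgZ_one_le_one_under hL u i₀ x₀ hu' h167u'
  have h := rbar_one_mul_sub_mul_le_geom_local_at hL a u i₀ x₀ p q hp0 hq0 hθ0 hθ2 hs' hs32' hθs' hpq'
    (fun l hl z hz => (hUa l hl z hz).1) (fun l hl z hz => (hUu l hl z hz).1) (fun l hl z hz => (hUu l hl z hz).2)
    (fun l hl z hz => (unitaryUnits_le_U1 (hwU l hl z hz)).2) (fun l hl z hz => (hUa l hl z hz).2) hp' hq'
  have e1 := congrFun (rbar_bgTZ_eq_uavgZ L (1 : SiteZ d → Fin d → 𝔹ˣ) (a * u) i₀) x₀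
  have e2 := congrFun (rbar_bgTZ_eq_uavgZ L (1 : SiteZ d → Fin d → 𝔹ˣ) a i₀) x₀
  have e3 := congrFun (rbar_bgTZ_eq_uavgZ L (1 : SiteZ d → Fin d → 𝔹ˣ) u i₀) x₀
  rw [e1, e2, e3] at h
  exact h

/-! ## §2  The product's averages are unitary under the cell -/

/-- ★★★ **THE RECORD AVERAGES OF THE PRODUCT `a·u` ARE UNITARY UNDER THE CELL** ([3] (22)–(23), (78)–(80); intertwined induction with the cross-term bound one level down):
for every `i ≤ j` and every `z` under `y` at depth `j − i`, `R̄₀ⁱ(a·u)(z) ∈ U(𝔹)`. [cite: Balaban1985Averaging, (78)–(80) p.30, (22)–(23) p.21, (26)–(27) pp.21–22, (167) p.44; Balaban1987RG1, (0.3)–(0.4) pp.252–253] -/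
theorem uavgZ_one_mul_mem_unitaryUnits_under {L : ℕ} (hL : Odd L) (a u : SiteZ d → 𝔹ˣ) (j : ℕ) (y : SiteZ d) (p q : ℕ → ℝ) {s θ : ℝ}
    (hp0 : ∀ i, 0 ≤ p i) (hq0 : ∀ i, 0 ≤ q i) (hθ0 : 0 ≤ θ) (hθ2 : θ ≤ 1 / 2) (hs0 : 0 ≤ s) (hs128 : s ≤ 1 / 128) (hθs : 1024 * θ * s ≤ 1)
    (hpq : ∀ i, i < j → p i + q i ≤ s * θ ^ (j - (i + 1)))
    (ha : ∀ x, UnderZ L j y x → a x ∈ unitaryUnits 𝔹) (hu : ∀ x, UnderZ L j y x → u x ∈ unitaryUnits 𝔹)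
    (hp : ∀ i, i < j → ∀ z, UnderZ L (j - (i + 1)) y z → ∀ x ∈ blockSitesZ L z,
      ‖(((uavgZ L (1 : SiteZ d → Fin d → 𝔹ˣ) a i ((L : ℤ) • z))⁻¹ : 𝔹ˣ) : 𝔹) * ((uavgZ L (1 : SiteZ d → Fin d → 𝔹ˣ) a i x : 𝔹ˣ) : 𝔹) - 1‖ ≤ p i)
    (hq : ∀ i, i < j → ∀ z, UnderZ L (j - (i + 1)) y z → ∀ x ∈ blockSitesZ L z,
      ‖(((uavgZ L (1 : SiteZ d → Fin d → 𝔹ˣ) u i ((L : ℤ) • z))⁻¹ : 𝔹ˣ) : 𝔹) * ((uavgZ L (1 : SiteZ d → Fin d → 𝔹ˣ) u i x : 𝔹ˣ) : 𝔹) - 1‖ ≤ q i) :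
    ∀ i, i ≤ j → ∀ z, UnderZ L (j - i) y z → uavgZ L (1 : SiteZ d → Fin d → 𝔹ˣ) (a * u) i z ∈ unitaryUnits 𝔹 := by
  have hL1 : 1 ≤ L := by obtain ⟨t, ht⟩ := hL; omega
  have hθ1 : θ ≤ 1 := hθ2.trans (by norm_num)
  -- unitarity of the factors' averages under the cell
  have hUa := uavgZ_one_mem_unitaryUnits_under hL a j y ha (h167_a a hp0 hq0 hθ0 hθ2 hs0 hs128 hpq hp)
  have hUu := uavgZ_one_mem_unitaryUnits_under hL u j y hu (h167_u u hp0 hq0 hθ0 hθ2 hs0 hs128 hpq hq)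
  -- cumulative induction
  suffices H : ∀ i, i ≤ j → ∀ l, l ≤ i → ∀ z, UnderZ L (j - l) y z → uavgZ L (1 : SiteZ d → Fin d → 𝔹ˣ) (a * u) l z ∈ unitaryUnits 𝔹 from
    fun i hi z hz => H i hi i le_rfl z hz
  intro i
  induction i with
  | zero =>
    intro _ l hl z hz
    obtain rfl : l = 0 := Nat.le_zero.1 hl
    rw [Nat.sub_zero] at hz
    rw [uavgZ_zero, Pi.mul_apply]
    exact (unitaryUnits 𝔹).mul_mem (ha z hz) (hu z hz)
  | succ i ih =>
    intro hi l hl z hz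
    rcases Nat.lt_or_ge l (i + 1) with hlt | hge
    · exact ih (by omega) l (by omega) z hz
    · obtain rfl : l = i + 1 := le_antisymm hl hge
      have hij : i < j := by omega
      have hdepth : j - (i + 1) + 1 = j - i := by omega
      -- the centre and the block points of `L·z` are under `y` at depth `j − i`; the product's level-`i` averages there are unitary
      have hz0 : UnderZ L (j - i) y ((L : ℤ) • z) := by have h := underZ_add hL hz (underZ_one_centre L z); rwa [hdepth] at h
      have hzr : ∀ r : Fin d → Fin L, UnderZ L (j - i) y ((L : ℤ) • z + offZ L r) := by
        intro r; obtain ⟨t, ht⟩ := hL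
        have h := underZ_add ⟨t, ht⟩ hz (underZ_one_block (by omega : L = 2 * t + 1) z r); rwa [hdepth] at h
      have hW0 : uavgZ L (1 : SiteZ d → Fin d → 𝔹ˣ) (a * u) i ((L : ℤ) • z) ∈ unitaryUnits 𝔹 := ih hij.le i le_rfl _ hz0
      have hWr : ∀ r, uavgZ L (1 : SiteZ d → Fin d → 𝔹ˣ) (a * u) i ((L : ℤ) • z + offZ L r) ∈ unitaryUnits 𝔹 := fun r => ih hij.le i le_rfl _ (hzr r)
      -- the cross-term bound at the sub-cells `L·z` and `L·z + r` (height `i`)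
      have hsub : ∀ x₀, UnderZ L (j - i) y x₀ → ∀ l, l < i → ∀ z', UnderZ L (i - (l + 1)) x₀ z' →
          uavgZ L (1 : SiteZ d → Fin d → 𝔹ˣ) (a * u) l ((L : ℤ) • z') ∈ unitaryUnits 𝔹 := by
        intro x₀ hx₀ l hl z' hz'
        have h1 : UnderZ L (i - l) x₀ ((L : ℤ) • z') := by
          have h := underZ_add hL hz' (underZ_one_centre L z'); rwa [show i - (l + 1) + 1 = i - l by omega] at h
        have h2 : UnderZ L (j - l) y ((L : ℤ) • z') := by
          have h := underZ_add hL hx₀ h1; rwa [show j - i + (i - l) = j - l by omega] at h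
        exact ih hij.le l (by omega) _ h2
      have hE0 := norm_uavgZ_one_mul_sub_mul_le_at_sub hL a u j y p q hp0 hq0 hθ0 hθ2 hs0 hs128 hθs hpq ha hu hp hq hij.le hz0 (hsub _ hz0)
      have hEr : ∀ r, _ := fun r => norm_uavgZ_one_mul_sub_mul_le_at_sub hL a u j y p q hp0 hq0 hθ0 hθ2 hs0 hs128 hθs hpq ha hu hp hq hij.le (hzr r) (hsub _ (hzr r))
      -- the letters at level `i`
      set E : ℝ := 1024 * (s * θ ^ (j - i)) ^ 2 with hEdef
      have hE : E ≤ 1 / 16 := by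
        have htp : θ ^ (j - i) ≤ 1 := pow_le_one₀ hθ0 hθ1
        have h1 : s * θ ^ (j - i) ≤ 1 / 128 := by nlinarith
        have h0 : 0 ≤ s * θ ^ (j - i) := by positivity
        rw [hEdef]; nlinarith
      obtain ⟨hp4, hq4⟩ := pq_le_quarter hp0 hq0 hθ0 hθ2 hs0 hs128 hpq hij
      have hpqi : p i + q i ≤ 1 / 64 := by
        have h := hpq i hij
        have htp : θ ^ (j - (i + 1)) ≤ 1 := pow_le_one₀ hθ0 hθ1
        nlinarith
      -- the product's (78) family at level `i` is within `1/4` of `1`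
      have hfam : ∀ r : Fin d → Fin L,
          ‖((((uavgZ L (1 : SiteZ d → Fin d → 𝔹ˣ) (a * u) i ((L : ℤ) • z))⁻¹ *
              uavgZ L (1 : SiteZ d → Fin d → 𝔹ˣ) (a * u) i ((L : ℤ) • z + offZ L r) : 𝔹ˣ)) : 𝔹) - 1‖ ≤ 1 / 4 := by
        intro r
        -- names
        set W0 := uavgZ L (1 : SiteZ d → Fin d → 𝔹ˣ) (a * u) i ((L : ℤ) • z) with hW0def
        set Wr := uavgZ L (1 : SiteZ d → Fin d → 𝔹ˣ) (a * u) i ((L : ℤ) • z + offZ L r) with hWrdef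
        set A0 := uavgZ L (1 : SiteZ d → Fin d → 𝔹ˣ) a i ((L : ℤ) • z) with hA0def
        set Ar := uavgZ L (1 : SiteZ d → Fin d → 𝔹ˣ) a i ((L : ℤ) • z + offZ L r) with hArdef
        set U0 := uavgZ L (1 : SiteZ d → Fin d → 𝔹ˣ) u i ((L : ℤ) • z) with hU0def
        set Ur := uavgZ L (1 : SiteZ d → Fin d → 𝔹ˣ) u i ((L : ℤ) • z + offZ L r) with hUrdef
        have hA0U : A0 ∈ unitaryUnits 𝔹 := hUa i hij.le _ hz0
        have hU0U : U0 ∈ unitaryUnits 𝔹 := hUu i hij.le _ hz0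
        have hUrU : Ur ∈ unitaryUnits 𝔹 := hUu i hij.le _ (hzr r)
        have hA0n : ‖(A0 : 𝔹)‖ ≤ 1 := (unitaryUnits_le_U1 hA0U).1
        have hUrn : ‖(Ur : 𝔹)‖ ≤ 1 := (unitaryUnits_le_U1 hUrU).1
        have hW0inv : ‖((W0⁻¹ : 𝔹ˣ) : 𝔹)‖ ≤ 1 := (unitaryUnits_le_U1 hW0).2
        -- `‖A_r − A_0‖ ≤ p_i`, `‖U_r − U_0‖ ≤ q_i`
        have hAr : ‖(Ar : 𝔹) - (A0 : 𝔹)‖ ≤ p i := by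
          have h := hp i hij z hz _ (mem_blockSitesZ.2 ⟨r, rfl⟩)
          have hid : (Ar : 𝔹) - (A0 : 𝔹) = (A0 : 𝔹) * ((((A0⁻¹ : 𝔹ˣ) : 𝔹) * (Ar : 𝔹)) - 1) := by
            rw [mul_sub, mul_one, ← mul_assoc, ← Units.val_mul, mul_inv_cancel, Units.val_one, one_mul]
          rw [hid]
          exact (norm_mul_le _ _).trans (by nlinarith [norm_nonneg ((((A0⁻¹ : 𝔹ˣ) : 𝔹) * (Ar : 𝔹)) - 1)])
        have hUr : ‖(Ur : 𝔹) - (U0 : 𝔹)‖ ≤ q i := by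
          have h := hq i hij z hz _ (mem_blockSitesZ.2 ⟨r, rfl⟩)
          have hU0n : ‖(U0 : 𝔹)‖ ≤ 1 := (unitaryUnits_le_U1 hU0U).1
          have hid : (Ur : 𝔹) - (U0 : 𝔹) = (U0 : 𝔹) * ((((U0⁻¹ : 𝔹ˣ) : 𝔹) * (Ur : 𝔹)) - 1) := by
            rw [mul_sub, mul_one, ← mul_assoc, ← Units.val_mul, mul_inv_cancel, Units.val_one, one_mul]
          rw [hid]
          exact (norm_mul_le _ _).trans (by nlinarith [norm_nonneg ((((U0⁻¹ : 𝔹ˣ) : 𝔹) * (Ur : 𝔹)) - 1)])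
        -- `‖A_rU_r − A_0U_0‖ ≤ p_i + q_i`
        have hprod : ‖(Ar : 𝔹) * (Ur : 𝔹) - (A0 : 𝔹) * (U0 : 𝔹)‖ ≤ p i + q i := by
          have hid : (Ar : 𝔹) * (Ur : 𝔹) - (A0 : 𝔹) * (U0 : 𝔹) = ((Ar : 𝔹) - (A0 : 𝔹)) * (Ur : 𝔹) + (A0 : 𝔹) * ((Ur : 𝔹) - (U0 : 𝔹)) := by
            noncomm_ring
          rw [hid]
          calc ‖((Ar : 𝔹) - (A0 : 𝔹)) * (Ur : 𝔹) + (A0 : 𝔹) * ((Ur : 𝔹) - (U0 : 𝔹))‖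
              ≤ ‖(Ar : 𝔹) - (A0 : 𝔹)‖ * ‖(Ur : 𝔹)‖ + ‖(A0 : 𝔹)‖ * ‖(Ur : 𝔹) - (U0 : 𝔹)‖ :=
                (norm_add_le _ _).trans (add_le_add (norm_mul_le _ _) (norm_mul_le _ _))
            _ ≤ p i * 1 + 1 * q i := add_le_add (mul_le_mul hAr hUrn (norm_nonneg _) (hp0 i)) (mul_le_mul hA0n hUr (norm_nonneg _) zero_le_one)
            _ = p i + q i := by ring
        -- `‖W_r − W_0‖ ≤ (p+q) + 2E`
        have hE0' : ‖(W0 : 𝔹) - (A0 : 𝔹) * (U0 : 𝔹)‖ ≤ E := hE0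
        have hEr' : ‖(Wr : 𝔹) - (Ar : 𝔹) * (Ur : 𝔹)‖ ≤ E := hEr r
        have hdiff : ‖(Wr : 𝔹) - (W0 : 𝔹)‖ ≤ p i + q i + 2 * E := by
          have hid : (Wr : 𝔹) - (W0 : 𝔹) = ((Wr : 𝔹) - (Ar : 𝔹) * (Ur : 𝔹)) + ((Ar : 𝔹) * (Ur : 𝔹) - (A0 : 𝔹) * (U0 : 𝔹)) - ((W0 : 𝔹) - (A0 : 𝔹) * (U0 : 𝔹)) := by
            abel
          rw [hid]
          calc ‖((Wr : 𝔹) - (Ar : 𝔹) * (Ur : 𝔹)) + ((Ar : 𝔹) * (Ur : 𝔹) - (A0 : 𝔹) * (U0 : 𝔹)) - ((W0 : 𝔹) - (A0 : 𝔹) * (U0 : 𝔹))‖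
              ≤ ‖(Wr : 𝔹) - (Ar : 𝔹) * (Ur : 𝔹)‖ + ‖(Ar : 𝔹) * (Ur : 𝔹) - (A0 : 𝔹) * (U0 : 𝔹)‖ + ‖(W0 : 𝔹) - (A0 : 𝔹) * (U0 : 𝔹)‖ :=
                (norm_sub_le _ _).trans (add_le_add (norm_add_le _ _) le_rfl)
            _ ≤ E + (p i + q i) + E := add_le_add (add_le_add hEr' hprod) hE0'
            _ = p i + q i + 2 * E := by ring
        -- `W_0⁻¹W_r − 1 = W_0⁻¹(W_r − W_0)`
        have hid : (((W0⁻¹ * Wr : 𝔹ˣ)) : 𝔹) - 1 = ((W0⁻¹ : 𝔹ˣ) : 𝔹) * ((Wr : 𝔹) - (W0 : 𝔹)) := by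
          rw [Units.val_mul, mul_sub, ← Units.val_mul W0⁻¹ W0, inv_mul_cancel, Units.val_one]
        rw [hid]
        calc ‖((W0⁻¹ : 𝔹ˣ) : 𝔹) * ((Wr : 𝔹) - (W0 : 𝔹))‖ ≤ ‖((W0⁻¹ : 𝔹ˣ) : 𝔹)‖ * ‖(Wr : 𝔹) - (W0 : 𝔹)‖ := norm_mul_le _ _
          _ ≤ 1 * (p i + q i + 2 * E) := by gcongr
          _ ≤ 1 / 4 := by linarith
      -- one step: `R̄₀^{i+1}(au)(z) = R̄₀ⁱ(au)(L·z) · exp S`, `S` skew-adjoint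
      have hstep : uavgZ L (1 : SiteZ d → Fin d → 𝔹ˣ) (a * u) (i + 1) z =
          uavgZ L (1 : SiteZ d → Fin d → 𝔹ˣ) (a * u) i ((L : ℤ) • z) * expUnit (SexpZ L (uavgZ L (1 : SiteZ d → Fin d → 𝔹ˣ) (a * u) i) ((L : ℤ) • z)) := by
        rw [uavgZ_succ, B7SectCDGaugeAveragesRec.R0avgZ, BlockAveragingZd.avgIterZ_one, B7Eq99Concrete.R0fun_one_left]
        rfl
      have hS_skew : SexpZ L (uavgZ L (1 : SiteZ d → Fin d → 𝔹ˣ) (a * u) i) ((L : ℤ) • z) ∈ skewAdjoint 𝔹 := by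
        unfold B7SectCDGaugeAveragesRec.SexpZ
        refine sum_mem fun r _ => skewAdjoint.smul_mem _ ?_
        rw [skewAdjoint.mem_iff]
        exact star_mlog_eq_neg ((mem_unitaryUnits).1 ((unitaryUnits 𝔹).mul_mem ((unitaryUnits 𝔹).inv_mem hW0) (hWr r))) (hfam r)
      rw [hstep, mem_unitaryUnits, Units.val_mul, val_expUnit]
      refine Submonoid.mul_mem _ ((mem_unitaryUnits).1 hW0) ?_
      letI : NormedAlgebra ℚ 𝔹 := NormedAlgebra.restrictScalars ℚ ℂ 𝔹
      exact NormedSpace.exp_mem_unitary_of_mem_skewAdjoint hS_skew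

/-! ## §3  The cross-term bound with no `U1` hypotheses -/

/-- ★★★ **THE CROSS-TERM BOUND OF THE RECORD AVERAGE OF A PRODUCT OF UNITARY GAUGE FUNCTIONS, `U1`-FREE**: under the geometric oscillation rows of `a` and `u` under the cell
(`p_i + q_i ≤ s·θ^{j−(i+1)}`, `θ ≤ 1∕2`, `s ≤ 1∕128`, `1024θs ≤ 1`) and pointwise unitarity of `a`, `u` there: `‖R̄₀ʲ(a·u)(y) − R̄₀ʲa(y)·R̄₀ʲu(y)‖ ≤ 1024·s²`.
[cite: Balaban1985Averaging, (78)–(81) p.30, (167) p.44, (22)–(23) p.21; Balaban1985RegularSpaces, (1.29) p.81; Balaban1987RG1, (0.3)–(0.4) pp.252–253] -/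
theorem norm_uavgZ_one_mul_sub_mul_le_of_unitary {L : ℕ} (hL : Odd L) (a u : SiteZ d → 𝔹ˣ) (j : ℕ) (y : SiteZ d) (p q : ℕ → ℝ) {s θ : ℝ}
    (hp0 : ∀ i, 0 ≤ p i) (hq0 : ∀ i, 0 ≤ q i) (hθ0 : 0 ≤ θ) (hθ2 : θ ≤ 1 / 2) (hs0 : 0 ≤ s) (hs128 : s ≤ 1 / 128) (hθs : 1024 * θ * s ≤ 1)
    (hpq : ∀ i, i < j → p i + q i ≤ s * θ ^ (j - (i + 1)))
    (ha : ∀ x, UnderZ L j y x → a x ∈ unitaryUnits 𝔹) (hu : ∀ x, UnderZ L j y x → u x ∈ unitaryUnits 𝔹)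
    (hp : ∀ i, i < j → ∀ z, UnderZ L (j - (i + 1)) y z → ∀ x ∈ blockSitesZ L z,
      ‖(((uavgZ L (1 : SiteZ d → Fin d → 𝔹ˣ) a i ((L : ℤ) • z))⁻¹ : 𝔹ˣ) : 𝔹) * ((uavgZ L (1 : SiteZ d → Fin d → 𝔹ˣ) a i x : 𝔹ˣ) : 𝔹) - 1‖ ≤ p i)
    (hq : ∀ i, i < j → ∀ z, UnderZ L (j - (i + 1)) y z → ∀ x ∈ blockSitesZ L z,
      ‖(((uavgZ L (1 : SiteZ d → Fin d → 𝔹ˣ) u i ((L : ℤ) • z))⁻¹ : 𝔹ˣ) : 𝔹) * ((uavgZ L (1 : SiteZ d → Fin d → 𝔹ˣ) u i x : 𝔹ˣ) : 𝔹) - 1‖ ≤ q i) :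
    ‖((uavgZ L (1 : SiteZ d → Fin d → 𝔹ˣ) (a * u) j y : 𝔹ˣ) : 𝔹) -
        ((uavgZ L (1 : SiteZ d → Fin d → 𝔹ˣ) a j y : 𝔹ˣ) : 𝔹) * ((uavgZ L (1 : SiteZ d → Fin d → 𝔹ˣ) u j y : 𝔹ˣ) : 𝔹)‖ ≤ 1024 * s ^ 2 := by
  have hU := uavgZ_one_mul_mem_unitaryUnits_under hL a u j y p q hp0 hq0 hθ0 hθ2 hs0 hs128 hθs hpq ha hu hp hq
  have hy : UnderZ L (j - j) y y := by rw [Nat.sub_self]; exact (underZ_zero_iff L y y).2 rfl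
  have h := norm_uavgZ_one_mul_sub_mul_le_at_sub hL a u j y p q hp0 hq0 hθ0 hθ2 hs0 hs128 hθs hpq ha hu hp hq le_rfl hy
    (fun l hl z hz => hU l hl.le _ (by
      have h := underZ_add hL hz (underZ_one_centre L z); rwa [show j - (l + 1) + 1 = j - l by omega] at h))
  rwa [Nat.sub_self, pow_zero, mul_one] at h

/-- ★★★ **ROAD (B′)'s ROW 9′ UP TO `ψ₂ := 1024·s²`, `U1`-FREE**: with the normalisations `R̄₀ʲa(y) = 1` (the junction's choice of the cell datum `X`) and `R̄₀ʲu(y) = 1` ((1.29) for Theorem 4's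
gauge), `‖R̄₀ʲ(a·u)(y) − 1‖ ≤ 1024·s²`. [cite: Balaban1985Averaging, (78)–(81) p.30; Balaban1985RegularSpaces, (1.29) p.81; Balaban1987RG1, (0.3)–(0.4) pp.252–253] -/
theorem norm_uavgZ_one_mul_sub_one_le_of_unitary {L : ℕ} (hL : Odd L) (a u : SiteZ d → 𝔹ˣ) (j : ℕ) (y : SiteZ d) (p q : ℕ → ℝ) {s θ : ℝ}
    (hp0 : ∀ i, 0 ≤ p i) (hq0 : ∀ i, 0 ≤ q i) (hθ0 : 0 ≤ θ) (hθ2 : θ ≤ 1 / 2) (hs0 : 0 ≤ s) (hs128 : s ≤ 1 / 128) (hθs : 1024 * θ * s ≤ 1)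
    (hpq : ∀ i, i < j → p i + q i ≤ s * θ ^ (j - (i + 1)))
    (ha : ∀ x, UnderZ L j y x → a x ∈ unitaryUnits 𝔹) (hu : ∀ x, UnderZ L j y x → u x ∈ unitaryUnits 𝔹)
    (hp : ∀ i, i < j → ∀ z, UnderZ L (j - (i + 1)) y z → ∀ x ∈ blockSitesZ L z,
      ‖(((uavgZ L (1 : SiteZ d → Fin d → 𝔹ˣ) a i ((L : ℤ) • z))⁻¹ : 𝔹ˣ) : 𝔹) * ((uavgZ L (1 : SiteZ d → Fin d → 𝔹ˣ) a i x : 𝔹ˣ) : 𝔹) - 1‖ ≤ p i)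
    (hq : ∀ i, i < j → ∀ z, UnderZ L (j - (i + 1)) y z → ∀ x ∈ blockSitesZ L z,
      ‖(((uavgZ L (1 : SiteZ d → Fin d → 𝔹ˣ) u i ((L : ℤ) • z))⁻¹ : 𝔹ˣ) : 𝔹) * ((uavgZ L (1 : SiteZ d → Fin d → 𝔹ˣ) u i x : 𝔹ˣ) : 𝔹) - 1‖ ≤ q i)
    (ha1 : uavgZ L (1 : SiteZ d → Fin d → 𝔹ˣ) a j y = 1) (hu1 : uavgZ L (1 : SiteZ d → Fin d → 𝔹ˣ) u j y = 1) :
    ‖((uavgZ L (1 : SiteZ d → Fin d → 𝔹ˣ) (a * u) j y : 𝔹ˣ) : 𝔹) - 1‖ ≤ 1024 * s ^ 2 := by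
  have h := norm_uavgZ_one_mul_sub_mul_le_of_unitary hL a u j y p q hp0 hq0 hθ0 hθ2 hs0 hs128 hθs hpq ha hu hp hq
  rwa [ha1, hu1, Units.val_one, mul_one] at h

end Main

end Literature.MathematicalPhysics.QuantumFieldTheory.Balaban1983to89.B8ExpMeanLogCrossTermUnitaryRec

end
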